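import Literature.NumberTheory.Rogawski1990.Ch12Sec5                          -- ★ CARPET `EllipticData`, `orbInt`, `WeylIntegrationFormula`, `IsClassFunOn` [§12.5 p. 182]
import Literature.NumberTheory.Rogawski1990.LocalTransferFundamentalLemma    -- ★ `IsLocSmooth` (test functions, §1.6)
import HarnessLib

/-!
# R90-TF · S4 (Ch. 13.1–2) · (W6-OD) — «ORBITAL INTEGRALS DETERMINE INVARIANT INTEGRALS», the GENERIC reduction (OD-G):
# at any §12.5 datum `𝔇` satisfying the Weyl integration formula, two test functions with the same REGULAR orbital integrals have the same
# integral against every invariant density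

Cell `hodgecm-mathlib`, crux H413 (`stmt-HodgeConjecture-24833`), route of record `HCCMUnconditional`; programme R90-TF (brief `director/R90-BRIEF.v2.md`
1f40d54518340a35), section S4 = Rogawski Ch. 13.1–2 (base `R90-C131`), RULING S4-R16 deal (W6-OD) to seat R90-C131-p04 (g0) (R90 bus 2026-09-04T22:56:46Z;
R0 census verdict 23:1xZ).  Lane `--supports stmt-HodgeConjecture-24833 --as helper`; THEOREMS ONLY (no definition, no instance, no notation, no `sorry`);
Literature imports only.

WHAT THIS FILE IS.  FILE B of S4 (`Cruxes/H413/Lines/R90_S4_HPacketsU2B.lean`, ED. 6 cand 89531339f2fc6098) splits its Harish-Chandra socket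
`stub_R90_S4_H_charDensityHC` into (HC-LI) «the character of an admissible class of `H_v` is an invariant `L¹_loc` function» and (ORB-DET)
`stub_R90_S4_H_orbDetWeyl` «for an invariant `L¹_loc` density `Θ` and test functions `f, f′` with the same CANONICAL orbital integrals at every `G`-regular
class, `∫ f Θ dνH = ∫ f′ Θ dνH`».  (ORB-DET) is the WEYL INTEGRATION FORMULA on `H_v = U(Φ₂)_v × U(Φ₁)_v` (for `L¹_loc` densities, compact-core-normalised
torus measures) plus the `dt`-nullity of the `G`-singular set — an analytic input the tree holds only as the NAMED Prop ★
`Ch12Sec5.EllipticData.WeylIntegrationFormula` over a §12.5 datum `𝔇` (discharged so far only for `G_v = U(Φ₃)_v`, ★ `F0P3cStCharTSWeylDatumPinsWIF`, modulo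
its tube-Jacobian socket; no `H_v` twin).  THIS FILE proves the GENERIC, group-agnostic reduction «(ORB-DET) ⇐ WIF(𝔇) + (REG-AE)(𝔇) + torus-side
integrability», so that the `H_v` statement is payable BY NAME at any pinned `H_v` datum the moment its Weyl integration formula is; nothing about `H_v`
itself is claimed here (HONEST LABEL).

THE MATHEMATICS ([Rogawski1990, §12.5 p. 182]: «`∫_{Z\G} f(g) α(g) dg = Σ_T |Ω(T,G)|⁻¹ ∫_{Z\T} D_G(γ)² Φ(γ, f) α(γ) dγ`» for class functions `α`).  Apply
the formula to `(f, α)` and to `(f′, α)`: the right-hand sides are sums over the same Cartan representatives `T ∈ 𝔇.cartanAll` of integrals of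
`D_G(t)² Φ(t, ·) α(t)`; if `Φ(γ, f) = Φ(γ, f′)` at every REGULAR `γ` and the non-regular points of each `T` are `dγ`-null (REG-AE), the two
integrands agree `dγ`-a.e. on every `T`, so the sums agree.  The convergence side conditions of the formula for `f′` follow from those for `f` by the
same a.e. equality; `f·α ∈ L¹(dg)` is automatic for a test function `f` (locally constant ⇒ continuous, compact support) and `α ∈ L¹_loc` (Mathlib
`LocallyIntegrable.integrable_smul_left_of_hasCompactSupport`), and an EVERYWHERE conjugation-invariant `α` is a class function on `G^r`.
* §1 `weylIntegrand_ae_eq_of_orbInt_eq` — the a.e. equality of the Weyl integrands on a Cartan representative.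
* §1 **`integral_mul_eq_of_orbInt_eq_of_weylIntegrationFormula`** — the reduction with the formula's convergence hypotheses for `f` explicit.
* §2 **`integral_mul_eq_of_orbInt_eq_of_isLocSmooth`** — the (ORB-DET)-shaped corollary: `IsLocSmooth f, f′`, `α` measurable, locally integrable and
  everywhere invariant; remaining inputs = WIF(𝔇), (REG-AE)(𝔇) and the torus-side integrability of `D² Φ(·, f) α` (print: Fubini on the tubes —
  part of the analytic package, kept as a binder).
The S4 dress (ED. 7 of FILE B, typist's pen): at an `H_v` datum `𝔇` pinned by `𝔇.μG = νH`, `𝔇.orb = mH` (so `𝔇.orbInt γ f = classOrbitalIntegral mH f ⟦γ⟧`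
definitionally) and `𝔇.regG = {IsLocalGRegular}`, `stub_R90_S4_H_orbDetWeyl` is §2 applied to the named inputs (WIF-H), (REG-AE-H), (INT-T-H).

HONEST LABEL: HC_CM is proved only modulo the 7 printed citations (2 remaining named inputs: hLiu418 = `stmt-HodgeConjecture-24832`, h413 =
`stmt-HodgeConjecture-24833`) until rung 0 closes; this file is a generic measure-theoretic reduction and discharges NO analytic input on `H_v` — the Weyl
integration formula for `U(Φ₂)_v × U(Φ₁)_v` remains to be built.  REL ≠ ★ ≠ BUILT.

## References
* [Rogawski1990] J. D. Rogawski, *Automorphic Representations of Unitary Groups in Three Variables*, Ann. of Math. Stud. 123 (1990): §12.5 p. 182 (the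
  Weyl integration formula); §4.1 pp. 39–40 (invariant and stable distributions, orbital integrals); §4.3 (4.3.1) p. 43 (normalisation of measures).
* [HarishChandra1970] Harish-Chandra, *Harmonic analysis on reductive p-adic groups*, LNM 162 (1970), Lemma 42 (Weyl integration formula).
* [DeitmarEchterhoff2014] A. Deitmar, S. Echterhoff, *Principles of Harmonic Analysis*, 2nd ed. (2014), Thm. 1.5.3 (quotient integral formula).
-/

set_option autoImplicit false
-- the mandated namespace repeats the single-problem summit's segment (`HodgeConjecture.HodgeConjecture`)
set_option linter.dupNamespace false

noncomputable section

open MeasureTheory Filter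
open Literature.NumberTheory.Rogawski1990 Literature.NumberTheory.Automorphic
open Literature.NumberTheory.Rogawski1990.Ch12Sec5

namespace Summit.HodgeConjecture.HodgeConjecture.R90.S4

/-! ## §0 Two bookkeeping lemmas (class functions; test function × locally integrable density) -/

section Bookkeeping

/-- An EVERYWHERE conjugation-invariant function is a class function on any set (★ `IsClassFunOn`). [cite: Rogawski1990, §12.5 p. 184] -/
theorem isClassFunOn_of_forall_conj_eq {G : Type} [Group G] (S : Set G) {α : G → ℂ} (hα : ∀ x g : G, α (x * g * x⁻¹) = α g) :
    IsClassFunOn S α :=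
  fun γ _ x => hα x γ

/-- **A test function times a locally integrable density is integrable**: for `f ∈ C_c^∞(G)` (★ `IsLocSmooth`: locally constant — hence continuous —
with compact support) and `α ∈ L¹_loc(μ)`, `f·α ∈ L¹(μ)` (Mathlib `LocallyIntegrable.integrable_smul_left_of_hasCompactSupport`).
[cite: Rogawski1990, §12.5 p. 182] [cite: DeitmarEchterhoff2014, Thm. 1.5.3] -/
theorem integrable_mul_of_isLocSmooth_of_locallyIntegrable {G : Type} [TopologicalSpace G] [MeasurableSpace G] [BorelSpace G] [T2Space G]
    (μ : Measure G) {f α : G → ℂ} (hf : IsLocSmooth f) (hα : LocallyIntegrable α μ) : Integrable (fun g => f g * α g) μ := by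
  have h := hα.integrable_smul_left_of_hasCompactSupport hf.1.continuous hf.2
  simpa only [smul_eq_mul] using h

end Bookkeeping

section Generic

variable {G H' : Type} [Group G] [TopologicalSpace G] [IsTopologicalGroup G] [MeasurableSpace G]
  [∀ γ : G, MeasurableSpace (G ⧸ Subgroup.centralizer ({γ} : Set G))] [MeasurableSpace (G ⧸ Subgroup.center G)]
  [Group H'] [TopologicalSpace H'] [IsTopologicalGroup H'] [MeasurableSpace H']

/-! ## §1 The reduction at a §12.5 datum satisfying the Weyl integration formula -/

/-- **The Weyl integrands of two functions with the same REGULAR orbital integrals agree a.e. on a Cartan representative** whose non-regular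
points are `dγ`-null: `D_G(t)² Φ(t, f) α(t) = D_G(t)² Φ(t, f′) α(t)` for `dγ`-a.e. `t ∈ T`. [cite: Rogawski1990, §12.5 p. 182] -/
theorem weylIntegrand_ae_eq_of_orbInt_eq (𝔇 : EllipticData G H') {T : Subgroup G}
    (hreg : ∀ᵐ t : ↥T ∂(𝔇.μT T), (t : G) ∈ 𝔇.regG) {f f' : G → ℂ} (hO : ∀ γ ∈ 𝔇.regG, 𝔇.orbInt γ f = 𝔇.orbInt γ f') (α : G → ℂ) :
    (fun t : ↥T => (𝔇.DG (t : G) : ℂ) ^ 2 * 𝔇.orbInt (t : G) f * α (t : G)) =ᵐ[𝔇.μT T]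
      (fun t : ↥T => (𝔇.DG (t : G) : ℂ) ^ 2 * 𝔇.orbInt (t : G) f' * α (t : G)) := by
  filter_upwards [hreg] with t ht
  rw [hO _ ht]

/-- **«REGULAR ORBITAL INTEGRALS DETERMINE INVARIANT INTEGRALS» at a §12.5 datum — the generic reduction (OD-G).**  Let `𝔇` satisfy the Weyl
integration formula (★ `EllipticData.WeylIntegrationFormula`, [§12.5 p. 182]) and let the non-regular points of every Cartan representative
`T ∈ 𝔇.cartanAll` be `dγ`-null (REG-AE).  If two test functions `f, f′ ∈ C_c^∞(G)` have the same orbital integrals `Φ(γ, f) = Φ(γ, f′)` at every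
REGULAR `γ`, then `∫ f α dg = ∫ f′ α dg` for every measurable class function `α` on `G^r` for which the formula's integrals converge for `f` (`f·α`,
`f′·α ∈ L¹(dg)` and `D_G² Φ(·, f) α ∈ L¹(T, dγ)` on each representative — the `f′`-side torus condition follows a.e.).  Proof: the formula for
`(f, α)` and `(f′, α)` has the same right-hand side term by term (`weylIntegrand_ae_eq_of_orbInt_eq`).
[cite: Rogawski1990, §12.5 p. 182; §4.1 pp. 39–40] [cite: HarishChandra1970, Lemma 42] -/
theorem integral_mul_eq_of_orbInt_eq_of_weylIntegrationFormula (𝔇 : EllipticData G H') (hWIF : 𝔇.WeylIntegrationFormula)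
    (hreg : ∀ T ∈ 𝔇.cartanAll, ∀ᵐ t : ↥T ∂(𝔇.μT T), (t : G) ∈ 𝔇.regG)
    {f f' : G → ℂ} (hf : f ∈ SchwartzBruhat G) (hf' : f' ∈ SchwartzBruhat G)
    (hO : ∀ γ ∈ 𝔇.regG, 𝔇.orbInt γ f = 𝔇.orbInt γ f')
    {α : G → ℂ} (hαm : Measurable α) (hαc : IsClassFunOn 𝔇.regG α)
    (hfα : Integrable (fun g => f g * α g) 𝔇.μG) (hf'α : Integrable (fun g => f' g * α g) 𝔇.μG)
    (hT : ∀ T ∈ 𝔇.cartanAll, Integrable (fun t : ↥T => (𝔇.DG (t : G) : ℂ) ^ 2 * 𝔇.orbInt (t : G) f * α (t : G)) (𝔇.μT T)) :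
    ∫ g, f g * α g ∂𝔇.μG = ∫ g, f' g * α g ∂𝔇.μG := by
  -- the torus-side convergence for `f′` from that for `f`, a.e.
  have hT' : ∀ T ∈ 𝔇.cartanAll,
      Integrable (fun t : ↥T => (𝔇.DG (t : G) : ℂ) ^ 2 * 𝔇.orbInt (t : G) f' * α (t : G)) (𝔇.μT T) :=
    fun T hTm => (hT T hTm).congr (weylIntegrand_ae_eq_of_orbInt_eq 𝔇 (hreg T hTm) hO α)
  -- the Weyl integration formula on both sides
  rw [hWIF f hf α hαm hαc hfα hT, hWIF f' hf' α hαm hαc hf'α hT']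
  refine Finset.sum_congr rfl fun T hTm => ?_
  rw [integral_congr_ae (weylIntegrand_ae_eq_of_orbInt_eq 𝔇 (hreg T hTm) hO α)]

/-! ## §2 The (ORB-DET)-shaped corollary: test functions, an everywhere-invariant locally integrable density -/

/-- **(ORB-DET) from the Weyl integration formula — the shape FILE B consumes.**  At a §12.5 datum `𝔇` with WIF(𝔇) and (REG-AE)(𝔇): for a measurable,
locally integrable, everywhere conjugation-invariant density `α` («`Θ`», e.g. the character of an admissible class by Harish-Chandra) and test functions
`f, f′ ∈ C_c^∞(G)` (★ `IsLocSmooth`) with `Φ(γ, f) = Φ(γ, f′)` at every regular `γ`, and the torus-side convergence of the formula for `(f, α)` (INT-T),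
`∫ f α ∂𝔇.μG = ∫ f′ α ∂𝔇.μG`.  [cite: Rogawski1990, §12.5 p. 182; §4.1 pp. 39–40] [cite: HarishChandra1970, Lemma 42] -/
theorem integral_mul_eq_of_orbInt_eq_of_isLocSmooth [BorelSpace G] [T2Space G] (𝔇 : EllipticData G H') (hWIF : 𝔇.WeylIntegrationFormula)
    (hreg : ∀ T ∈ 𝔇.cartanAll, ∀ᵐ t : ↥T ∂(𝔇.μT T), (t : G) ∈ 𝔇.regG)
    {α : G → ℂ} (hαm : Measurable α) (hαli : LocallyIntegrable α 𝔇.μG) (hαinv : ∀ x g : G, α (x * g * x⁻¹) = α g)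
    {f f' : G → ℂ} (hf : IsLocSmooth f) (hf' : IsLocSmooth f')
    (hO : ∀ γ ∈ 𝔇.regG, 𝔇.orbInt γ f = 𝔇.orbInt γ f')
    (hT : ∀ T ∈ 𝔇.cartanAll, Integrable (fun t : ↥T => (𝔇.DG (t : G) : ℂ) ^ 2 * 𝔇.orbInt (t : G) f * α (t : G)) (𝔇.μT T)) :
    ∫ g, f g * α g ∂𝔇.μG = ∫ g, f' g * α g ∂𝔇.μG :=
  integral_mul_eq_of_orbInt_eq_of_weylIntegrationFormula 𝔇 hWIF hreg (mem_schwartzBruhat_iff.2 ⟨hf.1, hf.2⟩)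
    (mem_schwartzBruhat_iff.2 ⟨hf'.1, hf'.2⟩) hO hαm (isClassFunOn_of_forall_conj_eq 𝔇.regG hαinv)
    (integrable_mul_of_isLocSmooth_of_locallyIntegrable 𝔇.μG hf hαli) (integrable_mul_of_isLocSmooth_of_locallyIntegrable 𝔇.μG hf' hαli) hT

end Generic

end Summit.HodgeConjecture.HodgeConjecture.R90.S4

end
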